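import Literature.RingTheory.TwoVariableSeries.Basic
import HarnessLib

/-!
# Two-variable formal power series: order and leading form

Topic: `Literature/RingTheory/TwoVariableSeries`. For `f ∈ F[[X₀, X₁]]` over a field, the
**leading form** `L(f)` is the homogeneous component of `f` of degree `ord f` (Cutkosky, Math.
Ann. 362 (2015), §3: "define the leading form of `F` to be `L(F) = Σ_{i+j=r} a_{ij} xⁱ yʲ` if
`ord(F) = r`"). This file packages Mathlib's `MvPowerSeries.order` / `homogeneousComponent` into
that notion (`leadingForm`, defined in `Basic.lean`) and this file proves what the discharge of
Cutkosky's Lemma 3.1 uses: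

* multiplicativity `leadingForm_mul` / `leadingForm_pow` (over a domain), values on
  units, variables and monomials, the characterisation `order_eq_and_leadingForm_eq`;
* degree-one components: `homogeneousComponent_one_mul_of_constantCoeff_eq_zero`, and the
  structure of two order-one series whose linear forms span the variables
  (`linearForms_of_span`): their leading forms are the degree-one components, nonzero, and no
  variable divides both;
* divisibility of homogeneous forms by a variable in terms of one coefficient, and by a power of a
  variable (`coeff_eq_zero_of_X_pow_dvd`).

Everything here is [folklore].
-/

noncomputable section

namespace Literature.RingTheory.TwoVariableSeries

open _root_.MvPowerSeries Finsupp

universe u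

variable {F : Type u} [Field F]

/-! ## Degrees of exponents in two variables -/

/-- `degree m = m 0 + m 1` on `Fin 2`. [folklore] -/
theorem degree_fin2 (m : Fin 2 →₀ ℕ) : degree m = m 0 + m 1 := by
  rw [degree_eq_sum, Fin.sum_univ_two]

/-- `Xᵃ Yᵇ` is the monomial of exponent `(a, b)`. [folklore] -/
theorem X_pow_mul_X_pow_eq_monomial (a b : ℕ) :
    (X 0 : MvPowerSeries (Fin 2) F) ^ a * X 1 ^ b =
      monomial (Finsupp.single 0 a + Finsupp.single 1 b) 1 := by
  rw [X_pow_eq, X_pow_eq, monomial_mul_monomial, one_mul]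

/-- Coefficients of `Xᵃ Yᵇ · φ`: shift by `(a, b)` when possible, else zero. [folklore] -/
theorem coeff_X_pow_mul_X_pow_mul (a b : ℕ) (φ : MvPowerSeries (Fin 2) F) (m : Fin 2 →₀ ℕ) :
    coeff m ((X 0 : MvPowerSeries (Fin 2) F) ^ a * X 1 ^ b * φ) =
      if a ≤ m 0 ∧ b ≤ m 1 then coeff (m - (Finsupp.single 0 a + Finsupp.single 1 b)) φ else 0 := by
  rw [X_pow_mul_X_pow_eq_monomial, coeff_monomial_mul]
  have hle : (Finsupp.single (0 : Fin 2) a + Finsupp.single 1 b) ≤ m ↔ a ≤ m 0 ∧ b ≤ m 1 := by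
    constructor
    · intro h
      exact ⟨by simpa using h 0, by simpa using h 1⟩
    · rintro ⟨h0, h1⟩ i
      fin_cases i
      · simpa using h0
      · simpa using h1
  by_cases h : a ≤ m 0 ∧ b ≤ m 1
  · rw [if_pos (hle.mpr h), if_pos h, one_mul]
  · rw [if_neg (fun h' => h (hle.mp h')), if_neg h]

/-! ## Homogeneous components in low degree -/

/-- The degree-zero component is the constant term. [folklore] -/
theorem homogeneousComponent_zero' (f : MvPowerSeries (Fin 2) F) :
    homogeneousComponent 0 f = C (constantCoeff f) := by
  classical
  ext d
  rw [coeff_homogeneousComponent, coeff_C]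
  by_cases hd : d = 0
  · subst hd
    simp
  · rw [if_neg (mt (degree_eq_zero_iff d).mp hd), if_neg hd]

/-- **Degree-one component of a product with a factor vanishing at the origin**:
`(f·g)₁ = f(0)·g₁` when `g(0) = 0`. [folklore] -/
theorem homogeneousComponent_one_mul_of_constantCoeff_eq_zero (f g : MvPowerSeries (Fin 2) F)
    (hg : constantCoeff g = 0) :
    homogeneousComponent 1 (f * g) = C (constantCoeff f) * homogeneousComponent 1 g := by
  have h1 : (1 : ℕ∞) ≤ g.order := by
    rw [← ENat.coe_one]
    exact nat_le_order fun d hd => by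
      have : d = 0 := by
        rw [← degree_eq_zero_iff]; omega
      rw [this, coeff_zero_eq_constantCoeff_apply, hg]
  have h := homogeneousComponent_mul_of_le_order (p := 0) (q := 1) (f := f) (g := g) (by simp) h1
  rw [zero_add] at h
  rw [h, homogeneousComponent_zero']

/-- A homogeneous series of degree `n` has no coefficients at exponents of other degrees (version
for the two coordinates; a deliberate dot-notation extension of Mathlib's
`MvPowerSeries.IsHomogeneous`). [folklore] -/
theorem _root_.MvPowerSeries.IsHomogeneous.coeff_eq_zero_fin2 {h : MvPowerSeries (Fin 2) F} {n : ℕ}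
    (hh : IsHomogeneous h n) {m : Fin 2 →₀ ℕ} (hm : m 0 + m 1 ≠ n) : coeff m h = 0 :=
  hh.coeff_eq_zero (by rwa [degree_fin2])

/-- **A variable divides a homogeneous form iff one coefficient vanishes**: for `h` homogeneous of
degree `n`, `X k ∣ h ↔ coeff (X_{k.rev})ⁿ h = 0`. [folklore] -/
theorem X_dvd_iff_of_isHomogeneous {h : MvPowerSeries (Fin 2) F} {n : ℕ} (hh : IsHomogeneous h n)
    (k : Fin 2) : (X k : MvPowerSeries (Fin 2) F) ∣ h ↔ coeff (Finsupp.single k.rev n) h = 0 := by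
  rw [X_dvd_iff]
  constructor
  · intro H
    exact H _ (by rw [Finsupp.single_eq_of_ne (fin2_rev_ne k).symm])
  · intro H m hm
    have hm' : m k.rev.rev = 0 := by rwa [Fin.rev_rev]
    rw [finsupp_eq_single_of_rev_eq_zero hm']
    by_cases hn : m k.rev = n
    · rw [hn]; exact H
    · apply hh.coeff_eq_zero
      rw [degree_single]
      exact hn

/-- A homogeneous form restricts to a monomial on each axis: `killVar k h = (coeff) · tⁿ`.
[folklore] -/
theorem killVar_of_isHomogeneous {h : MvPowerSeries (Fin 2) F} {n : ℕ} (hh : IsHomogeneous h n)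
    (k : Fin 2) : killVar k h = PowerSeries.C (coeff (Finsupp.single k.rev n) h) * PowerSeries.X ^ n := by
  ext i
  rw [coeff_killVar, PowerSeries.coeff_C_mul_X_pow]
  split_ifs with hi
  · rw [hi]
  · apply hh.coeff_eq_zero
    rw [degree_single]
    exact hi

/-- **Divisibility by a power of a variable kills low coefficients**: if `X kᴺ ∣ q` then every
coefficient of `q` at an exponent with `k`-component `< N` vanishes. [folklore] -/
theorem coeff_eq_zero_of_X_pow_dvd {k : Fin 2} {N : ℕ} {q : MvPowerSeries (Fin 2) F}
    (h : (X k : MvPowerSeries (Fin 2) F) ^ N ∣ q) {m : Fin 2 →₀ ℕ} (hm : m k < N) : coeff m q = 0 :=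
  (X_pow_dvd_iff.mp h) m hm

/-! ## The leading form -/

/-- **Characterisation**: if the degree-`n` component of `f` is nonzero and all coefficients of
degree `< n` vanish, then `ord f = n` and `L(f)` is that component. [folklore] -/
theorem order_eq_and_leadingForm_eq {f : MvPowerSeries (Fin 2) F} {n : ℕ}
    (hn : homogeneousComponent n f ≠ 0) (hlt : ∀ d : Fin 2 →₀ ℕ, degree d < n → coeff d f = 0) :
    f.order = n ∧ leadingForm f = homogeneousComponent n f := by
  have hord : f.order = n := by
    apply le_antisymm _ (nat_le_order hlt)
    by_contra hgt
    exact hn (homogeneousComponent_of_lt_order_eq_zero (not_le.mp hgt))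
  refine ⟨hord, ?_⟩
  rw [leadingForm, hord, ENat.toNat_coe]

/-- **Multiplicativity of leading forms** (over a field `F[[X,Y]]` is a domain):
`L(fg) = L(f) L(g)`. [folklore] -/
theorem leadingForm_mul (f g : MvPowerSeries (Fin 2) F) :
    leadingForm (f * g) = leadingForm f * leadingForm g := by
  by_cases hf : f = 0
  · simp [hf]
  by_cases hg : g = 0
  · simp [hg]
  have hfg : f * g ≠ 0 := mul_ne_zero hf hg
  have hord : (f * g).order.toNat = f.order.toNat + g.order.toNat := by
    have h := order_mul f g
    rw [← order_toNat_eq hf, ← order_toNat_eq hg, ← order_toNat_eq hfg, ← Nat.cast_add] at h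
    exact_mod_cast h
  rw [leadingForm, hord, homogeneousComponent_mul_of_le_order (order_toNat_eq hf).le
    (order_toNat_eq hg).le]
  rfl

/-- `L(fⁿ) = L(f)ⁿ`. [folklore] -/
theorem leadingForm_pow (f : MvPowerSeries (Fin 2) F) (n : ℕ) :
    leadingForm (f ^ n) = leadingForm f ^ n := by
  induction n with
  | zero =>
    rw [pow_zero, pow_zero, leadingForm]
    have h1 : (1 : MvPowerSeries (Fin 2) F).order.toNat = 0 := by
      rw [order_eq_nat.mpr ⟨⟨0, by simp, by simp⟩, fun d hd => (Nat.not_lt_zero _ hd).elim⟩]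
      rfl
    rw [h1, homogeneousComponent_zero', constantCoeff_one, map_one]
  | succ n ih => rw [pow_succ, leadingForm_mul, ih, pow_succ]

/-- The order of a series with nonzero constant term is `0`. [folklore] -/
theorem order_toNat_eq_zero_of_constantCoeff_ne_zero {f : MvPowerSeries (Fin 2) F}
    (hf : constantCoeff f ≠ 0) : f.order.toNat = 0 := by
  have h : f.order = (0 : ℕ) :=
    order_eq_nat.mpr ⟨⟨0, by rwa [coeff_zero_eq_constantCoeff_apply], by simp⟩,
      fun d hd => (Nat.not_lt_zero _ hd).elim⟩
  rw [h]
  rfl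

/-- **Leading form of a unit**: its constant term. [folklore] -/
theorem leadingForm_of_constantCoeff_ne_zero {f : MvPowerSeries (Fin 2) F} (hf : constantCoeff f ≠ 0) :
    leadingForm f = C (constantCoeff f) := by
  rw [leadingForm, order_toNat_eq_zero_of_constantCoeff_ne_zero hf, homogeneousComponent_zero']

/-- Leading form of a unit. [folklore] -/
theorem leadingForm_of_isUnit {f : MvPowerSeries (Fin 2) F} (hf : IsUnit f) :
    leadingForm f = C (constantCoeff f) :=
  leadingForm_of_constantCoeff_ne_zero (by
    rw [isUnit_iff_constantCoeff] at hf
    exact hf.ne_zero)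

/-- A homogeneous nonzero series is its own leading form, of order its degree. [folklore] -/
theorem order_eq_and_leadingForm_eq_self_of_isHomogeneous {h : MvPowerSeries (Fin 2) F} {n : ℕ}
    (hh : IsHomogeneous h n) (h0 : h ≠ 0) : h.order = n ∧ leadingForm h = h := by
  have heq : homogeneousComponent n h = h := (isHomogeneous_iff_eq_homogeneousComponent.mp hh).symm
  have := order_eq_and_leadingForm_eq (f := h) (n := n) (by rwa [heq]) fun d hd =>
    hh.coeff_eq_zero hd.ne
  rw [heq] at this
  exact this

/-- A monomial is homogeneous of degree its total degree. [folklore] -/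
theorem isHomogeneous_monomial' (d : Fin 2 →₀ ℕ) (a : F) :
    IsHomogeneous (monomial d a : MvPowerSeries (Fin 2) F) (degree d) := by
  classical
  intro m hm
  rw [coeff_monomial] at hm
  split_ifs at hm with h
  · rw [h, degree_eq_weight_one]
    rfl
  · exact (hm rfl).elim

/-- `Xᵃ Yᵇ` is homogeneous of degree `a + b`. [folklore] -/
theorem isHomogeneous_X_pow_mul_X_pow (a b : ℕ) :
    IsHomogeneous ((X 0 : MvPowerSeries (Fin 2) F) ^ a * X 1 ^ b) (a + b) := by
  have h : IsHomogeneous (monomial (Finsupp.single 0 a + Finsupp.single 1 b) (1 : F) :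
      MvPowerSeries (Fin 2) F) (degree (Finsupp.single (0 : Fin 2) a + Finsupp.single 1 b)) :=
    isHomogeneous_monomial' _ 1
  rw [map_add, degree_single, degree_single] at h
  rwa [X_pow_mul_X_pow_eq_monomial]

/-- **Leading form of `Xᵃ Yᵇ`** is itself (order `a + b`). [folklore] -/
theorem leadingForm_X_pow_mul_X_pow (a b : ℕ) :
    ((X 0 : MvPowerSeries (Fin 2) F) ^ a * X 1 ^ b).order = ((a + b : ℕ) : ℕ∞) ∧
      leadingForm ((X 0 : MvPowerSeries (Fin 2) F) ^ a * X 1 ^ b) = X 0 ^ a * X 1 ^ b :=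
  order_eq_and_leadingForm_eq_self_of_isHomogeneous (isHomogeneous_X_pow_mul_X_pow a b)
    (mul_ne_zero (pow_ne_zero _ (X_ne_zero' 0)) (pow_ne_zero _ (X_ne_zero' 1)))

/-- A variable is homogeneous of degree one. [folklore] -/
theorem isHomogeneous_X (k : Fin 2) : IsHomogeneous (X k : MvPowerSeries (Fin 2) F) 1 := by
  have h : IsHomogeneous (monomial (Finsupp.single k 1) (1 : F) : MvPowerSeries (Fin 2) F)
      (degree (Finsupp.single k 1)) := isHomogeneous_monomial' _ 1
  rwa [degree_single, ← X_def] at h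

/-- `ord (X k) = 1` and `L(X k) = X k`. [folklore] -/
theorem leadingForm_X (k : Fin 2) :
    (X k : MvPowerSeries (Fin 2) F).order = ((1 : ℕ) : ℕ∞) ∧
      leadingForm (X k : MvPowerSeries (Fin 2) F) = X k :=
  order_eq_and_leadingForm_eq_self_of_isHomogeneous (isHomogeneous_X k) (X_ne_zero' k)

/-- Powers of homogeneous series (a deliberate dot-notation extension of Mathlib's
`MvPowerSeries.IsHomogeneous`, stated for two variables over a field). [folklore] -/
theorem _root_.MvPowerSeries.IsHomogeneous.pow_fin2 {f : MvPowerSeries (Fin 2) F} {m : ℕ}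
    (hf : IsHomogeneous f m) (n : ℕ) : IsHomogeneous (f ^ n) (m * n) := by
  induction n with
  | zero =>
    rw [pow_zero, mul_zero]
    intro d hd
    classical
    rw [coeff_one] at hd
    split_ifs at hd with h
    · rw [h]; simp
    · exact (hd rfl).elim
  | succ n ih =>
    rw [pow_succ, Nat.mul_succ]
    exact ih.mul hf

/-- Constants are homogeneous of degree zero. [folklore] -/
theorem isHomogeneous_C (a : F) : IsHomogeneous (C a : MvPowerSeries (Fin 2) F) 0 := by
  have h : IsHomogeneous (monomial 0 a : MvPowerSeries (Fin 2) F) (degree (0 : Fin 2 →₀ ℕ)) :=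
    isHomogeneous_monomial' _ a
  rwa [map_zero, monomial_zero_eq_C_apply] at h

/-! ## Order-one series whose linear forms span the variables -/

/-- If `f(0) = 0` and the degree-one component of `f` is nonzero then `ord f = 1` and `L(f)` is that
component. [folklore] -/
theorem order_eq_one_of_homogeneousComponent_one_ne_zero {f : MvPowerSeries (Fin 2) F}
    (hf : constantCoeff f = 0) (h1 : homogeneousComponent 1 f ≠ 0) :
    f.order = (1 : ℕ) ∧ leadingForm f = homogeneousComponent 1 f :=
  order_eq_and_leadingForm_eq h1 fun d hd => by
    have : d = 0 := by rw [← degree_eq_zero_iff]; omega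
    rw [this, coeff_zero_eq_constantCoeff_apply, hf]

/-- A variable is not a scalar multiple of the other variable's linear form: if
`X k = C a * ℓ` and `X k.rev = C b * ℓ` then `False`. [folklore] -/
theorem false_of_X_eq_C_mul_of_X_rev_eq_C_mul {ℓ : MvPowerSeries (Fin 2) F} {a b : F} (k : Fin 2)
    (h1 : (X k : MvPowerSeries (Fin 2) F) = C a * ℓ) (h2 : (X k.rev : MvPowerSeries (Fin 2) F) = C b * ℓ) :
    False := by
  have e1 := congrArg (coeff (Finsupp.single k 1)) h1
  have e2 := congrArg (coeff (Finsupp.single k 1)) h2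
  rw [coeff_single_one_X_self, coeff_C_mul] at e1
  rw [coeff_single_one_X_rev, coeff_C_mul] at e2
  have hb : b = 0 := by
    rcases mul_eq_zero.mp e2.symm with hb | hl
    · exact hb
    · rw [hl, mul_zero] at e1; exact (one_ne_zero e1).elim
  rw [hb, map_zero, zero_mul] at h2
  exact X_ne_zero' k.rev h2

/-- **Two order-one series whose linear forms span the variables.** If `f₁(0) = f₂(0) = 0` and
both variables are combinations `X k = r_k f₁ + s_k f₂` with coefficients in `F[[X,Y]]`, then
`ord fᵢ = 1`, `L(fᵢ)` is the degree-one component of `fᵢ` (nonzero), and no variable divides both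
`L(f₁)` and `L(f₂)` (they are linearly independent linear forms). [folklore] -/
theorem linearForms_of_span {f₁ f₂ : MvPowerSeries (Fin 2) F} (h₁ : constantCoeff f₁ = 0)
    (h₂ : constantCoeff f₂ = 0)
    (hspan : ∀ k : Fin 2, ∃ r s : MvPowerSeries (Fin 2) F, (X k : MvPowerSeries (Fin 2) F) = r * f₁ + s * f₂) :
    (f₁.order = (1 : ℕ) ∧ leadingForm f₁ = homogeneousComponent 1 f₁) ∧
    (f₂.order = (1 : ℕ) ∧ leadingForm f₂ = homogeneousComponent 1 f₂) ∧
    (∀ k : Fin 2, ¬ ((X k : MvPowerSeries (Fin 2) F) ∣ homogeneousComponent 1 f₁ ∧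
        (X k : MvPowerSeries (Fin 2) F) ∣ homogeneousComponent 1 f₂)) := by
  -- degree-one components of the relations
  have hlin : ∀ k : Fin 2, ∃ a b : F, (X k : MvPowerSeries (Fin 2) F) =
      C a * homogeneousComponent 1 f₁ + C b * homogeneousComponent 1 f₂ := by
    intro k
    obtain ⟨r, s, hrs⟩ := hspan k
    refine ⟨constantCoeff r, constantCoeff s, ?_⟩
    have h := congrArg (homogeneousComponent 1) hrs
    rw [map_add, homogeneousComponent_one_mul_of_constantCoeff_eq_zero r f₁ h₁,
      homogeneousComponent_one_mul_of_constantCoeff_eq_zero s f₂ h₂] at h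
    rw [← h]
    exact ((isHomogeneous_iff_eq_homogeneousComponent).mp (isHomogeneous_X k))
  -- neither degree-one component vanishes
  have hne : ∀ (g₁ g₂ : MvPowerSeries (Fin 2) F),
      (∀ k : Fin 2, ∃ a b : F, (X k : MvPowerSeries (Fin 2) F) = C a * g₁ + C b * g₂) → g₁ ≠ 0 := by
    intro g₁ g₂ hl hz
    obtain ⟨a0, b0, e0⟩ := hl 0
    obtain ⟨a1, b1, e1⟩ := hl 1
    rw [hz, mul_zero, zero_add] at e0 e1
    exact false_of_X_eq_C_mul_of_X_rev_eq_C_mul (ℓ := g₂) 0 e0 (by simpa using e1)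
  have hne₁ : homogeneousComponent 1 f₁ ≠ 0 := hne _ _ hlin
  have hne₂ : homogeneousComponent 1 f₂ ≠ 0 :=
    hne _ _ fun k => by
      obtain ⟨a, b, e⟩ := hlin k
      exact ⟨b, a, by rw [e, add_comm]⟩
  refine ⟨order_eq_one_of_homogeneousComponent_one_ne_zero h₁ hne₁,
    order_eq_one_of_homogeneousComponent_one_ne_zero h₂ hne₂, fun k ⟨hd₁, hd₂⟩ => ?_⟩
  -- if `X k` divided both linear forms it would divide `X k.rev`
  obtain ⟨a, b, e⟩ := hlin k.rev
  have hdvd : (X k : MvPowerSeries (Fin 2) F) ∣ X k.rev := by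
    rw [e]
    exact dvd_add (dvd_mul_of_dvd_right hd₁ _) (dvd_mul_of_dvd_right hd₂ _)
  have := (X_dvd_iff.mp hdvd) (Finsupp.single k.rev 1) (by rw [Finsupp.single_eq_of_ne (fin2_rev_ne k).symm])
  rw [coeff_single_one_X_self] at this
  exact one_ne_zero this

/-! ## Divisibility of products of linear forms by a variable -/

/-- **A variable dividing a product of powers of two linear forms divides one of them** (with a
positive exponent): for `ℓ₁, ℓ₂` homogeneous of degree one and `c ≠ 0`, if
`X k ∣ C c · ℓ₁ᵃ · ℓ₂ᵇ` then `X k ∣ ℓ₁` with `a ≥ 1`, or `X k ∣ ℓ₂` with `b ≥ 1`. [folklore] -/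
theorem X_dvd_linear_pow_mul_pow {ℓ₁ ℓ₂ : MvPowerSeries (Fin 2) F} {c : F} (hc : c ≠ 0) (k : Fin 2)
    {a b : ℕ} (h : (X k : MvPowerSeries (Fin 2) F) ∣ C c * ℓ₁ ^ a * ℓ₂ ^ b) :
    ((X k : MvPowerSeries (Fin 2) F) ∣ ℓ₁ ∧ 1 ≤ a) ∨ ((X k : MvPowerSeries (Fin 2) F) ∣ ℓ₂ ∧ 1 ≤ b) := by
  rw [← killVar_eq_zero_iff, map_mul, map_mul, map_pow, map_pow, killVar_C] at h
  have hC : (PowerSeries.C c : PowerSeries F) ≠ 0 := (map_ne_zero PowerSeries.C).mpr hc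
  rcases mul_eq_zero.mp h with h' | h'
  · rcases mul_eq_zero.mp h' with h'' | h''
    · exact (hC h'').elim
    · have ha : a ≠ 0 := by rintro rfl; rw [pow_zero] at h''; exact one_ne_zero h''
      exact Or.inl ⟨(killVar_eq_zero_iff k _).mp ((pow_eq_zero_iff ha).mp h''),
        Nat.one_le_iff_ne_zero.mpr ha⟩
  · have hb : b ≠ 0 := by rintro rfl; rw [pow_zero] at h'; exact one_ne_zero h'
    exact Or.inr ⟨(killVar_eq_zero_iff k _).mp ((pow_eq_zero_iff hb).mp h'),
      Nat.one_le_iff_ne_zero.mpr hb⟩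

/-! ## Specialisations to the two coordinates

Versions of the `k`/`k.rev` lemmas of `Basic.lean` with the indices `0`, `1` written out, so that
they can be used by `rw` (where `(1 : Fin 2).rev` and `0` are not syntactically equal). -/

section Coordinates

variable {R : Type u} [CommRing R]

/-- `coeff tⁿ (killVar 0 f) = coeff Yⁿ f`. [folklore] -/
theorem coeff_killVar_zero (f : MvPowerSeries (Fin 2) R) (n : ℕ) :
    PowerSeries.coeff n (killVar 0 f) = coeff (Finsupp.single 1 n) f :=
  coeff_killVar 0 f n

/-- `coeff tⁿ (killVar 1 f) = coeff Xⁿ f`. [folklore] -/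
theorem coeff_killVar_one (f : MvPowerSeries (Fin 2) R) (n : ℕ) :
    PowerSeries.coeff n (killVar 1 f) = coeff (Finsupp.single 0 n) f :=
  coeff_killVar 1 f n

/-- `killVar 0 (X 1 ^ n) = tⁿ`. [folklore] -/
theorem killVar_zero_X_one_pow (n : ℕ) : killVar 0 ((X 1 : MvPowerSeries (Fin 2) R) ^ n) = PowerSeries.X ^ n := by
  rw [map_pow, killVar_zero_X_one]

/-- `killVar 1 (X 0 ^ n) = tⁿ`. [folklore] -/
theorem killVar_one_X_zero_pow (n : ℕ) : killVar 1 ((X 0 : MvPowerSeries (Fin 2) R) ^ n) = PowerSeries.X ^ n := by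
  rw [map_pow, killVar_one_X_zero]

/-- `coeff_Y (X · f) = 0`. [folklore] -/
theorem coeff_single_one_one_X_zero_mul (f : MvPowerSeries (Fin 2) R) :
    coeff (Finsupp.single 1 1) (X 0 * f) = 0 :=
  coeff_single_one_X_rev_mul 1 f

/-- `coeff_X (Y · f) = 0`. [folklore] -/
theorem coeff_single_zero_one_X_one_mul (f : MvPowerSeries (Fin 2) R) :
    coeff (Finsupp.single 0 1) (X 1 * f) = 0 :=
  coeff_single_one_X_rev_mul 0 f

/-- `coeff_Y (Xⁿ · f) = 0` for `n ≠ 0`. [folklore] -/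
theorem coeff_single_one_one_X_zero_pow_mul {n : ℕ} (hn : n ≠ 0) (f : MvPowerSeries (Fin 2) R) :
    coeff (Finsupp.single 1 1) (X 0 ^ n * f) = 0 :=
  coeff_single_one_X_rev_pow_mul 1 hn f

/-- `coeff_X (Yⁿ · f) = 0` for `n ≠ 0`. [folklore] -/
theorem coeff_single_zero_one_X_one_pow_mul {n : ℕ} (hn : n ≠ 0) (f : MvPowerSeries (Fin 2) R) :
    coeff (Finsupp.single 0 1) (X 1 ^ n * f) = 0 :=
  coeff_single_one_X_rev_pow_mul 0 hn f

/-- `coeff_Y (X) = 0`. [folklore] -/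
theorem coeff_single_one_one_X_zero : coeff (Finsupp.single 1 1) (X 0 : MvPowerSeries (Fin 2) R) = 0 :=
  coeff_single_one_X_rev 1

/-- `coeff_X (Y) = 0`. [folklore] -/
theorem coeff_single_zero_one_X_one : coeff (Finsupp.single 0 1) (X 1 : MvPowerSeries (Fin 2) R) = 0 :=
  coeff_single_one_X_rev 0

/-- The constant term of a positive power of a variable vanishes. [folklore] -/
theorem constantCoeff_X_pow {n : ℕ} (hn : n ≠ 0) (k : Fin 2) :
    constantCoeff ((X k : MvPowerSeries (Fin 2) R) ^ n) = 0 := by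
  rw [map_pow, constantCoeff_X, zero_pow hn]

/-- `coeff_{X_k}(X_kⁿ · f) = 0` for `n ≥ 2`. [folklore] -/
theorem coeff_single_one_X_self_pow_mul {k : Fin 2} {n : ℕ} (hn : 2 ≤ n) (f : MvPowerSeries (Fin 2) R) :
    coeff (Finsupp.single k 1) (X k ^ n * f) = 0 := by
  obtain ⟨m, rfl⟩ := Nat.exists_eq_add_of_le hn
  rw [pow_add, pow_two, mul_assoc, mul_assoc, coeff_single_one_X_mul, map_mul, constantCoeff_X, zero_mul]

/-- Coefficients of an embedded one-variable series off its axis vanish. [folklore] -/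
theorem coeff_toMvPowerSeries_eq_zero_of_apply_rev_ne_zero (j : Fin 2) (g : PowerSeries R) {m : Fin 2 →₀ ℕ}
    (hm : m j.rev ≠ 0) : coeff m (PowerSeries.toMvPowerSeries j g) = 0 := by
  rw [PowerSeries.toMvPowerSeries_apply, coeff_rename_eq_zero]
  rintro ⟨x, rfl⟩
  exact hm (Finsupp.mapDomain_notin_range _ _ fun ⟨_, ha⟩ => fin2_rev_ne j ha.symm)

/-- A series embedded along `Y` has no coefficient at exponents involving `X`. [folklore] -/
theorem coeff_toMvPowerSeries_one_eq_zero (g : PowerSeries R) {m : Fin 2 →₀ ℕ} (hm : m 0 ≠ 0) :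
    coeff m (PowerSeries.toMvPowerSeries 1 g) = 0 :=
  coeff_toMvPowerSeries_eq_zero_of_apply_rev_ne_zero 1 g hm

/-- `killVar 0` is left inverse to embedding along `Y`. [folklore] -/
theorem killVar_zero_toMvPowerSeries_one (g : PowerSeries R) : killVar 0 (PowerSeries.toMvPowerSeries 1 g) = g :=
  killVar_toMvPowerSeries 0 g

/-- The constant term of an embedded one-variable series. [folklore] -/
theorem constantCoeff_toMvPowerSeries (j : Fin 2) (g : PowerSeries R) :
    constantCoeff (PowerSeries.toMvPowerSeries j g) = PowerSeries.constantCoeff g := by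
  rw [PowerSeries.toMvPowerSeries_apply, constantCoeff_rename]
  rfl

end Coordinates

end Literature.RingTheory.TwoVariableSeries
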